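import Mathlib
import Summits.Ventures.PercRepro2.Defs
import Summits.Ventures.PercRepro2.Harris
import Summits.Ventures.PercRepro2.Independence
import Summits.Ventures.PercRepro2.CoinDefs
import Summits.Ventures.PercRepro2.CoinReverse
import Summits.Ventures.PercRepro2.CoinStarDefs
import Summits.Ventures.PercRepro2.CoinLsmCoreDefs
import Summits.Ventures.PercRepro2.CoinLsmCoreU
import Summits.Ventures.PercRepro2.CoinCoreGate
import Summits.Ventures.PercRepro2.CoinTreeCore
import Summits.Ventures.PercRepro2.CoinD21Alg
import Summits.Ventures.PercRepro2.CoinOrTailAlg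
import Summits.Ventures.PercRepro2.CoinOrTailDefs
import Summits.Ventures.PercRepro2.CoinOrTailCore
import Summits.Ventures.PercRepro2.CoinOrTail3Cells
import Summits.Ventures.PercRepro2.CoinOrTail3Alg
import Summits.Ventures.PercRepro2.CoinTreeAncestor

/-!
# Row 2′DARC at the OR-TAIL over two log-supermodular branches with ONE FAR MARKER, at every
head (blind cell PercRepro2, night-2 g9; proofs/NIGHT2-DARC.md §36)

`darc_of_orTailCore3`: as `darc_of_orTailCore`, but the marker of the first branch is a vertex
`p` that every cluster containing the attachment point `r` of the tail also contains (`p` is a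
cut vertex between `s` and `r` inside the branch; `hcut`).  The seven core sums factorise as
before (`OrTailCore.sum_R_eq` / `sum_G_eq` with the tail triggered by `r`), and the abstract
functional is `orTail3_functional_nonneg` — the five-vertex certificate `d21_cert` lifted by
Ahlswede–Daykin.  Corollary `darc_of_orTailTrees3`: both branches out-trees and `p` an ancestor
of `r` — every directed two-route core `s → p₁ → … → p_k → a ← q_l ← … ← q₁ ← s` with the
markers `p_m` (any `1 ≤ m ≤ k`) and `q_l`.
-/

namespace Summit.Ventures.PercRepro2.Coin

open Classical


section OrTail3Main

variable {V : Type*} {E : Type*} [Fintype V] [DecidableEq V] [Fintype E] [DecidableEq E]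
  {R : Type*} [Field R] [LinearOrder R] [IsStrictOrderedRing R]
  {arcs : E → Finset (V × V)} {s : V} {B₁ B₂ : Finset V} {p r q a w : V} {cρ cτ : E}

/-- **THEOREM (row 2′DARC at the OR-tail over two log-supermodular branches, ONE FAR MARKER,
every head).**  Hypotheses: as `darc_of_orTailCore` with the tail attached at `r ∈ B₁` and
`q ∈ B₂`, plus a marker `p ∈ B₁` such that every branch-1 cluster containing `r` contains `p`
(`hcut`: the level of a set containing `r` but not `p` has probability `0`).  Conclusion:
`Φ_D({s ↛ t in D + (a → w)}) ≥ 0` for the markers `p, q`. -/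
theorem darc_of_orTailCore3 (pr : E → R) (hp : IsProbVec pr) (hS : SameEnds arcs)
    (h : OrTailCore arcs s B₁ B₂ r q a cρ cτ) (hpB : p ∈ B₁)
    (hcut : ∀ W ⊆ B₁, r ∈ W → p ∉ W → prob pr (coreLevel arcs s B₁ W) = 0)
    (hν₁ : ∀ W W', W ⊆ B₁ → W' ⊆ B₁ →
      prob pr (coreLevel arcs s B₁ W) * prob pr (coreLevel arcs s B₁ W') ≤
        prob pr (coreLevel arcs s B₁ (W ∩ W')) * prob pr (coreLevel arcs s B₁ (W ∪ W')))
    (hν₂ : ∀ W W', W ⊆ B₂ → W' ⊆ B₂ →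
      prob pr (coreLevel arcs s B₂ W) * prob pr (coreLevel arcs s B₂ W') ≤
        prob pr (coreLevel arcs s B₂ (W ∩ W')) * prob pr (coreLevel arcs s B₂ (W ∪ W')))
    {t : V} (htC : t ∉ insert a (B₁ ∪ B₂)) (hts : t ≠ s) (hws : w ≠ s)
    (hwC : w ∉ insert a (B₁ ∪ B₂)) :
    DARC pr arcs s {t} p q a w := by
  have hC := h.closedInCoreU
  have hpa : p ≠ a := fun e => h.a_notin₁ (e ▸ hpB)
  have hpC : p ∈ insert a (B₁ ∪ B₂) := by simp [hpB]
  have hqC : q ∈ insert a (B₁ ∪ B₂) := by simp [h.q_mem]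
  have haC : a ∈ insert a (B₁ ∪ B₂) := Finset.mem_insert_self _ _
  unfold DARC
  rw [hC.phiC_gate_eq pr hS htC hts hpC hqC haC hws hwC]
  -- the seven core sums as branch sums (the tail triggered by `r`)
  have hm1 : ∀ W : Finset V, (fun _ : Finset V => (1 : R)) (insert a W) = (fun _ => (1 : R)) W :=
    fun _ => rfl
  have hmp : ∀ W : Finset V, (fun W : Finset V => if p ∈ W then (1 : R) else 0) (insert a W) =
      (fun W : Finset V => if p ∈ W then (1 : R) else 0) W := by
    intro W; simp only [Finset.mem_insert, hpa, false_or]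
  have hmq : ∀ W : Finset V, (fun W : Finset V => if q ∈ W then (1 : R) else 0) (insert a W) =
      (fun W : Finset V => if q ∈ W then (1 : R) else 0) W := by
    intro W; simp only [Finset.mem_insert, h.q_ne_a, false_or]
  have hmpq : ∀ W : Finset V,
      (fun W : Finset V => (if p ∈ W then (1 : R) else 0) * (if q ∈ W then (1 : R) else 0))
        (insert a W) =
      (fun W : Finset V => (if p ∈ W then (1 : R) else 0) * (if q ∈ W then (1 : R) else 0)) W := by
    intro W; simp only [Finset.mem_insert, hpa, h.q_ne_a, false_or]
  have eΛ := h.sum_R_eq hS pr t (fun _ => (1 : R)) hm1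
  have eFa := h.sum_R_eq hS pr t (fun W => if p ∈ W then (1 : R) else 0) hmp
  have eFb := h.sum_R_eq hS pr t (fun W => if q ∈ W then (1 : R) else 0) hmq
  have eM := h.sum_G_eq (w := w) hS pr t (fun _ => (1 : R)) hm1
  have eX := h.sum_G_eq (w := w) hS pr t (fun W => if p ∈ W then (1 : R) else 0) hmp
  have eY := h.sum_G_eq (w := w) hS pr t (fun W => if q ∈ W then (1 : R) else 0) hmq
  have eXY := h.sum_G_eq (w := w) hS pr t
    (fun W => (if p ∈ W then (1 : R) else 0) * (if q ∈ W then (1 : R) else 0)) hmpq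
  simp only [mul_one] at eΛ eM
  rw [eΛ, eFa, eFb, eM, eX, eY, eXY]
  -- the abstract functional
  set U := B₁ ∪ B₂ with hU
  set A : Finset V → R := fun X => prob pr (coreAvoidEvent arcs s t (insert a U) X) with hA
  set ν : Finset V → R := fun W =>
    prob pr (coreLevel arcs s B₁ (W ∩ B₁)) * prob pr (coreLevel arcs s B₂ (W ∩ B₂)) with hν
  have haU : a ∉ U := h.a_notin
  have hwU : w ∉ U := fun hw => hwC (Finset.mem_insert_of_mem hw)
  have hν0 : ∀ W, 0 ≤ ν W := fun W => mul_nonneg (prob_nonneg hp _) (prob_nonneg hp _)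
  have hbad : ∀ W ⊆ U, r ∈ W → p ∉ W → ν W = 0 := by
    intro W _ hrW hpW
    simp only [hν]
    rw [hcut (W ∩ B₁) Finset.inter_subset_right (Finset.mem_inter.2 ⟨hrW, h.p_mem⟩)
      (fun hh => hpW (Finset.mem_inter.1 hh).1), zero_mul]
  have hνlsm : ∀ s' ⊆ U, ∀ t' ⊆ U, ν s' * ν t' ≤ ν (s' ∩ t') * ν (s' ∪ t') := by
    intro s' _ t' _
    have e1 : (s' ∩ t') ∩ B₁ = (s' ∩ B₁) ∩ (t' ∩ B₁) := by
      ext x; simp only [Finset.mem_inter]; tauto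
    have e2 : (s' ∩ t') ∩ B₂ = (s' ∩ B₂) ∩ (t' ∩ B₂) := by
      ext x; simp only [Finset.mem_inter]; tauto
    have e3 : (s' ∪ t') ∩ B₁ = (s' ∩ B₁) ∪ (t' ∩ B₁) := by
      ext x; simp only [Finset.mem_inter, Finset.mem_union]; tauto
    have e4 : (s' ∪ t') ∩ B₂ = (s' ∩ B₂) ∪ (t' ∩ B₂) := by
      ext x; simp only [Finset.mem_inter, Finset.mem_union]; tauto
    have h1 := hν₁ (s' ∩ B₁) (t' ∩ B₁) Finset.inter_subset_right Finset.inter_subset_right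
    have h2 := hν₂ (s' ∩ B₂) (t' ∩ B₂) Finset.inter_subset_right Finset.inter_subset_right
    simp only [hν, e1, e2, e3, e4]
    calc prob pr (coreLevel arcs s B₁ (s' ∩ B₁)) * prob pr (coreLevel arcs s B₂ (s' ∩ B₂)) *
          (prob pr (coreLevel arcs s B₁ (t' ∩ B₁)) * prob pr (coreLevel arcs s B₂ (t' ∩ B₂)))
        = (prob pr (coreLevel arcs s B₁ (s' ∩ B₁)) * prob pr (coreLevel arcs s B₁ (t' ∩ B₁))) *
          (prob pr (coreLevel arcs s B₂ (s' ∩ B₂)) * prob pr (coreLevel arcs s B₂ (t' ∩ B₂))) := by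
          ring
      _ ≤ (prob pr (coreLevel arcs s B₁ (s' ∩ B₁ ∩ (t' ∩ B₁))) *
            prob pr (coreLevel arcs s B₁ (s' ∩ B₁ ∪ t' ∩ B₁))) *
          (prob pr (coreLevel arcs s B₂ (s' ∩ B₂ ∩ (t' ∩ B₂))) *
            prob pr (coreLevel arcs s B₂ (s' ∩ B₂ ∪ t' ∩ B₂))) :=
          mul_le_mul h1 h2 (mul_nonneg (prob_nonneg hp _) (prob_nonneg hp _))
            (mul_nonneg (prob_nonneg hp _) (prob_nonneg hp _))
      _ = prob pr (coreLevel arcs s B₁ (s' ∩ B₁ ∩ (t' ∩ B₁))) *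
            prob pr (coreLevel arcs s B₂ (s' ∩ B₂ ∩ (t' ∩ B₂))) *
          (prob pr (coreLevel arcs s B₁ (s' ∩ B₁ ∪ t' ∩ B₁)) *
            prob pr (coreLevel arcs s B₂ (s' ∩ B₂ ∪ t' ∩ B₂))) := by ring
  have hA0 : ∀ X, 0 ≤ A X := fun X => prob_nonneg hp _
  have hAmono : ∀ X Y : Finset V, X ⊆ Y → A Y ≤ A X := by
    intro X Y hXY
    simp only [hA]
    apply prob_mono hp
    intro ω hω v hv
    exact hω v (Finset.insert_subset_insert s hXY hv)
  have hAlsm : ∀ X Y : Finset V, A X * A Y ≤ A (X ∩ Y) * A (X ∪ Y) := by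
    intro X Y
    have hh := vdBKC_rev pr hp (sameEnds_coreOff (C := insert a U) hS) t ∅ ∅
      (insert s X) (insert s Y)
    have hi : insert s X ∩ insert s Y = insert s (X ∩ Y) := (Finset.insert_inter_distrib X Y s).symm
    have hun : insert s X ∪ insert s Y = insert s (X ∪ Y) := (Finset.insert_union_distrib s X Y).symm
    rw [hi, hun] at hh
    simp only [hA, coreAvoidEvent]
    simpa only [Finset.notMem_empty, false_imp_iff, implies_true, Set.setOf_true, Set.univ_inter,
      Finset.empty_union] using hh
  exact orTail3_functional_nonneg U ν A p r q a w (pr cρ) (pr cτ) haU hwU (hp.nonneg cρ)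
    (hp.le_one cρ) (hp.nonneg cτ) (hp.le_one cτ) hν0 hνlsm hbad hA0 hAlsm hAmono

/-- **COROLLARY (two out-tree branches, the first marker an ancestor of the attachment
point).**  `p = par₁^[j] r` with the intermediate vertices in `B₁`: every directed two-route
core `s → p₁ → … → p_k → a ← q_l ← … ← q₁ ← s` with the markers `p_m` (`1 ≤ m ≤ k`) and `q_l`,
and every pair of rooted trees with `p` above `r`. -/
theorem darc_of_orTailTrees3 (pr : E → R) (hp : IsProbVec pr) (hS : SameEnds arcs)
    (h : OrTailCore arcs s B₁ B₂ r q a cρ cτ)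
    {c₁ : V → E} {par₁ : V → V} {rk₁ : V → ℕ} (h₁ : TreeCore arcs s B₁ c₁ par₁ rk₁)
    {c₂ : V → E} {par₂ : V → V} {rk₂ : V → ℕ} (h₂ : TreeCore arcs s B₂ c₂ par₂ rk₂)
    (hpB : p ∈ B₁) {j : ℕ} (hj : ∀ i < j, par₁^[i] r ∈ B₁) (hjp : par₁^[j] r = p)
    {t : V} (htC : t ∉ insert a (B₁ ∪ B₂)) (hts : t ≠ s) (hws : w ≠ s)
    (hwC : w ∉ insert a (B₁ ∪ B₂)) :
    DARC pr arcs s {t} p q a w := by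
  refine darc_of_orTailCore3 pr hp hS h hpB ?_ (h₁.coreLevel_lsm pr hp) (h₂.coreLevel_lsm pr hp)
    htC hts hws hwC
  intro W _ hrW hpW
  have hempty : coreLevel arcs s B₁ W = ∅ := by
    ext ω
    simp only [Set.mem_empty_iff_false, iff_false]
    intro hω
    have hr : Reach arcs ω s r := (mem_coreLevel.mp hω r h.p_mem).mp hrW
    have hpr : Reach arcs ω s p := hjp ▸ h₁.reach_iterate_par hr j hj
    exact hpW ((mem_coreLevel.mp hω p hpB).mpr hpr)
  rw [hempty, prob_empty]

end OrTail3Main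

end Summit.Ventures.PercRepro2.Coin
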